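import Summits.BirchSwinnertonDyer.BirchSwinnertonDyer.Theses.BiquadraticEisensteinDescent
import Summits.BirchSwinnertonDyer.Rank1Residual.X11b.BDPRouteHsiehFrameSupplied
import Literature.NumberTheory.EllipticCurves.Hsieh2014.AnticyclotomicPAdicLFunctionAnyLevel
import Literature.FieldTheory.AlgClosed.PadicAlgClEquivComplex
import HarnessLib

/-!
# Crux (W) `KatzWaldspurgerFrameCMInertBad` of route `BiquadraticEisensteinDescent`: its ♭-EXISTENCE HALF
# from print — Hsieh 2014 Thm. A at EVERY level (tree fact, `v_p(N) ≥ 2` allowed) gives, at every datum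
# of (W), a frame `Q ∈ 𝓞_{ℂ_p}⟦T⟧` with Castella's interpolation property (`R1.IsBDPLFunctionInt`)

Item stmt-BirchSwinnertonDyer-20240 (crux (W), rank 3) of `route-BirchSwinnertonDyer-BiquadraticEisensteinDescent`
(W-ALL row 12, K12i: `W/ℚ` with CM by `K_W`, analytic rank 1, `p ≥ 5` inert in `K_W`, `p ∣ N` — additive,
`a_p = 0`, `p² ∣ N` —, descended over an auxiliary Heegner field `K′` in which `p` SPLITS). (W) asks, at every
Heegner datum, for a frame `(f, ι′, Ω_K′ ≠ 0, Ω_p ∈ R₀ˣ, L ∈ R₀⟦T⟧)` with `IsBDPLFunction ι′ 𝔭 κ γ f Ω_K′ Ω_p L`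
(Castella 2018 Thm. 3.1's display, `R₀ = 𝒪(ℚ̂_p^ur)`) AND the value `L(𝟙) = u·(log_ω P)²`, `u ∈ R₀ˣ`.

HONEST FRAMING. This file does NOT close (W). It records, kernel-checked, which part of (W) is PRINT today:

* **`exists_isBDPLFunctionInt_of_thmA_anyLevel`** — for EVERY datum of (W) (indeed for every newform `f` of
  `W` and every embedding datum `ι′` inducing `𝔭`, which is more than (W) asks), the named fact
  `Hsieh2014.thmA_exists_isHsiehLFunction_unrPeriod_anyLevel` (Hsieh, Doc. Math. 19 (2014) Thm. A, typed at
  every level: the binder `¬ p² ∣ N` of the companion fact dropped by the reading (E1″) of the Coates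
  multiplier at an additive prime — `L(½, π_p ⊗ χ_𝔭) = 1`, `ε(½, π_p ⊗ χ_𝔭) = ±χ_𝔭(p)^a`) yields a frame
  `(Ω_K′ ≠ 0, Ω_p ∈ R₀ˣ, Q ∈ 𝓞_{ℂ_p}⟦T⟧)` with `R1.IsBDPLFunctionInt p ι′ 𝔭 κ γ f Ω_K′ Ω_p Q` — Castella's
  interpolation property VERBATIM, over the wide receptacle `𝓞_{ℂ_p}⟦T⟧`. Inputs, all tree THEOREMS: the
  λ-supply at every odd prime (`X11b.lambdaSupplyAt`: an anticyclotomic `λ` of type `(1,−1)` with avatar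
  through `κ`), the display glue Hsieh → Castella at `p ∣ N` (`X11b.exists_isBDPLFunctionInt_of_isHsiehLFunction`:
  the real monomial `(p/(16A²))ⁿ` absorbed by the complex period, the unit constant `C` by the element),
  `p ∣ N_W ⇔ ¬ good` (`dvd_conductorNorm_iff_not_hasGoodReductionAtPrime`), `p` split in `K′` from the
  Heegner hypothesis at `p ∣ N`. CONDITIONAL on the one published fact `hA`; nothing else assumed.
* **`exists_frameInt_of_thmA_anyLevel`** — the same packaged in the EXACT `∃`-shape of (W)'s conclusion
  (`∃ f, IsNewformOf W f ∧ ∃ ι′, compat ∧ ∃ Ω_K′ Ω_p Q, Ω_K′ ≠ 0 ∧ …`) minus the value clause and with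
  `Q ∈ 𝓞_{ℂ_p}⟦T⟧` for `L ∈ R₀⟦T⟧`: `f := Dt.f`, `ι′` from `PadicAlgCl.nonempty_ringEquiv_complex` +
  `X11b.exists_datum_forall_mem_iff`.

WHAT SEPARATES THIS FROM (W) (not in print at `p² ∣ N`; recorded for the route author, not attempted here):
(d) the `R₀`-DESCENT `Q ↦ L ∈ R₀⟦T⟧`, `Ω_p ∈ R₀ˣ` (the analogue of x11b3's named residual
`Three.HsiehDescentAt₃`; Castella–Hsieh 2018 Def. 3.5 prints `R₀`-coefficients only for `p ∤ N`, Castella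
2018 Thm. 3.1 only for `N` square-free), and (v) the VALUE AT `𝟙` `= u·(log_ω P)²` with `u` a UNIT
(BDP 2013 Thm. 5.13: `p ∤ N`; Castella 2018 Thm. 3.2: `N` square-free; Liu–Zhang–Zhang 2018 Thms. 1.6/1.8
give a `p`-adic Waldspurger formula for ANY `π_p` with `p` split in `K′`, but only up to the `p`-adic Petersson
scalar and local toric periods — no integral, unit-exact statement). The route's deciding theorem `closes`
uses of the frame only `‖[T⁰]G‖ ≤ 1` for the cofactor and `‖u‖ = 1` — both available over `𝓞_{ℂ_p}` —, so
(d) is not load-bearing for the route; (v) is the crux.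

References: [Hsieh2014] Doc. Math. 19 (2014) 709–767, Thm. A (p. 712) = arXiv:1112.1580 Thm. 1;
[Castella2018] Camb. J. Math. 6 (2018), Thms. 3.1–3.2 (arXiv:1704.06608 p. 9); [CastellaHsieh2018] Math.
Ann. 370 (2018), Def. 3.5 / Prop. 3.6; [BertoliniDarmonPrasanna2013] Duke Math. J. 162, Thm. 5.13;
[LiuZhangZhang2018] Duke Math. J. 167 (2018) 743–833 = arXiv:1511.08172, Thms. 1.6, 1.8 (pp. 3–5).

File with: `ledger propose --kind proof --target
  Summits/BirchSwinnertonDyer/BirchSwinnertonDyer/Theorems/BiquadraticEisensteinDescentKatzWaldspurgerFrameCMInertBadFromPrint.lean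
  --file work/FromPrint.lean --supports stmt-BirchSwinnertonDyer-20240 --as helper`.
-/

set_option autoImplicit false

-- D-0017 layout: summit = sub-problem, so `Summit.BirchSwinnertonDyer.BirchSwinnertonDyer.…` is the
-- mandated namespace of Theorems files (same option as the route's sibling Theorems files).
set_option linter.dupNamespace false

noncomputable section

open scoped Classical

namespace Summit.BirchSwinnertonDyer.BirchSwinnertonDyer.Theorems.BiquadraticEisensteinDescentKatzWaldspurgerFrameCMInertBadFromPrint

open WeierstrassCurve NumberField IsDedekindDomain Field PowerSeries
  Literature.NumberTheory.GaloisRepresentations Literature.NumberTheory.EllipticCurves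
  Literature.NumberTheory.EllipticCurves.ModularForms Literature.NumberTheory.EllipticCurves.Rank1Residual
  Literature.NumberTheory.EllipticCurves.Hsieh2014
  Summit.BirchSwinnertonDyer.Rank1Residual Summit.BirchSwinnertonDyer.Rank1Residual.X11b

/-- **The ♭-existence half of (W) from Hsieh 2014 Thm. A at every level.** For `W/ℚ` (elliptic) with bad
reduction at an odd prime `p`, a newform `f` of `W` at level `N_W`, an imaginary quadratic `K′` satisfying the
Heegner hypothesis for `N_W` (so `p` splits in `K′`), an anticyclotomic `ℤ_p`-extension `κ` with topological
generator `γ`, a prime `𝔭 ∋ p` of `K′` and an embedding datum `ι′ : ℚ̄_p ≃ ℂ` inducing `𝔭`: the named fact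
`thmA_exists_isHsiehLFunction_unrPeriod_anyLevel` gives `Ω_K′ ≠ 0`, `Ω_p ∈ R₀ˣ` and `Q ∈ 𝓞_{ℂ_p}⟦T⟧` with
Castella's interpolation property `R1.IsBDPLFunctionInt p ι′ 𝔭 κ γ f Ω_K′ Ω_p Q`. No CM, rank, `p ≥ 5`,
`R₀` or value hypothesis is used: this is the print-shaped part of crux (W) (and of its registered stub
`stub_W1`) in the wide receptacle. CONDITIONAL on the published fact `hA` only.
[cite: Hsieh2014, Thm. A p. 712 (Doc. Math. 19) = Thm. 1 (arXiv:1112.1580 pp. 3–4)]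
[cite: Castella2018, Thm. 3.1 (arXiv:1704.06608 p. 9) (shape of the conclusion)] -/
theorem exists_isBDPLFunctionInt_of_thmA_anyLevel (hA : thmA_exists_isHsiehLFunction_unrPeriod_anyLevel)
    (W : WeierstrassCurve ℚ) [W.IsElliptic] (p : ℕ) [Fact p.Prime] [NeZero (W.conductorNorm ℤ)]
    (K : Type) [Field K] [NumberField K]
    (f : CuspForm (CongruenceSubgroup.Gamma0 (W.conductorNorm ℤ)) 2) (hnf : IsNewformOf W f)
    (hp2 : p ≠ 2) (hbad : ¬ Good W p) (hK : IsImaginaryQuadratic K)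
    (hHN : SatisfiesHeegnerHypothesis (W.conductorNorm ℤ) K)
    (κ : ZpExtension K p) (hκ : κ.IsAnticyclotomic) (γ : Field.absoluteGaloisGroup K)
    [hγ : Fact (κ.IsTopGenerator γ)] (𝔭 : HeightOneSpectrum (𝓞 K)) (h𝔭 : ((p : ℕ) : 𝓞 K) ∈ 𝔭.asIdeal)
    (ι' : PadicAlgCl p ≃+* ℂ)
    (hι' : ∀ (w : InfinitePlace K) (k : 𝓞 K), k ∈ 𝔭.asIdeal ↔ ‖ι'.symm (w.embedding (k : K))‖ < 1) :
    ∃ (ΩK : ℂ) (Ωp : (unrIntegers p)ˣ) (Q : PowerSeries (PadicComplexInt p)), ΩK ≠ 0 ∧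
      R1.IsBDPLFunctionInt p ι' 𝔭 κ γ f ΩK ((Ωp : unrIntegers p) : ℂ_[p]) Q := by
  have hp : p.Prime := Fact.out
  have hpN : p ∣ W.conductorNorm ℤ := (W.dvd_conductorNorm_iff_not_hasGoodReductionAtPrime p).mpr hbad
  have hsplit : ((Ideal.span {(p : ℤ)}).primesOver (𝓞 K)).ncard = 2 := hHN p hp hpN
  obtain ⟨lam, rlam, hunit, hinfl, hAQ, hunrl, havl, hfacl⟩ := lambdaSupplyAt hp2 ι' K κ hK hκ
  obtain ⟨A, ΩK, C, Ωp, Q, hA0, hΩK, hC, hQ⟩ :=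
    hA ι' K 𝔭 κ γ f lam rlam hp2 hnf.1 hK hsplit h𝔭 hι' hHN hunit hinfl hAQ hunrl havl hfacl hκ hγ.out
  obtain ⟨ΩK₁, c, hΩK₁, -, hBDP⟩ :=
    exists_isBDPLFunctionInt_of_isHsiehLFunction ι' 𝔭 κ γ f hpN hA0 hΩK hC
      ((Ωp : unrIntegers p) : ℂ_[p]) hQ
  exact ⟨ΩK₁, Ωp, _, hΩK₁, hBDP⟩

/-- **The ♭-existence half of (W) in the `∃`-shape of (W)'s conclusion.** Over the binders of
`KatzWaldspurgerFrameCMInertBad` that the existence half uses (a parametrisation datum `Dt` supplying the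
newform `f := Dt.f`, `p ≥ 5`, bad reduction at `p`, `K′` imaginary quadratic with the Heegner hypothesis,
`(κ, γ, 𝔭)`), the named fact `hA` gives: `∃ f, IsNewformOf W f ∧ ∃ ι′` inducing `𝔭` `∧ ∃ Ω_K′ Ω_p Q,
Ω_K′ ≠ 0 ∧ R1.IsBDPLFunctionInt p ι′ 𝔭 κ γ f Ω_K′ Ω_p Q` — (W)'s conclusion with `L ∈ R₀⟦T⟧` widened to
`Q ∈ 𝓞_{ℂ_p}⟦T⟧` and WITHOUT the value clause `L(𝟙) = u·(log_ω P)²`. The embedding datum is one of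
`ι₀, ι₀ ∘ conj` for any `ι₀ : ℚ̄_p ≃ ℂ` (`PadicAlgCl.nonempty_ringEquiv_complex`, `exists_datum_forall_mem_iff`).
CONDITIONAL on `hA` only; the `R₀`-descent and the value at `𝟙` are NOT claimed.
[cite: Hsieh2014, Thm. A p. 712 (Doc. Math. 19) = Thm. 1 (arXiv:1112.1580 pp. 3–4)]
[cite: Castella2018, Thm. 3.1 (arXiv:1704.06608 p. 9) (shape of the conclusion)] -/
theorem exists_frameInt_of_thmA_anyLevel (hA : thmA_exists_isHsiehLFunction_unrPeriod_anyLevel)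
    (W : WeierstrassCurve ℚ) [W.IsElliptic] (p : ℕ) [Fact p.Prime] [NeZero (W.conductorNorm ℤ)]
    (K : Type) [Field K] [NumberField K]
    (Dt : ModularParametrizationData W (W.conductorNorm ℤ)) (hp5 : 5 ≤ p) (hbad : ¬ Good W p)
    (hK : IsImaginaryQuadratic K) (hHN : SatisfiesHeegnerHypothesis (W.conductorNorm ℤ) K)
    (κ : ZpExtension K p) (hκ : κ.IsAnticyclotomic) (γ : Field.absoluteGaloisGroup K)
    [Fact (κ.IsTopGenerator γ)] (𝔭 : HeightOneSpectrum (𝓞 K)) (h𝔭 : ((p : ℕ) : 𝓞 K) ∈ 𝔭.asIdeal) :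
    ∃ (f : CuspForm (CongruenceSubgroup.Gamma0 (W.conductorNorm ℤ)) 2), IsNewformOf W f ∧
      ∃ ι' : PadicAlgCl p ≃+* ℂ,
        (∀ (w : InfinitePlace K) (k : 𝓞 K), k ∈ 𝔭.asIdeal ↔ ‖ι'.symm (w.embedding (k : K))‖ < 1) ∧
        ∃ (ΩK : ℂ) (Ωp : (unrIntegers p)ˣ) (Q : PowerSeries (PadicComplexInt p)), ΩK ≠ 0 ∧
          R1.IsBDPLFunctionInt p ι' 𝔭 κ γ f ΩK ((Ωp : unrIntegers p) : ℂ_[p]) Q := by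
  obtain ⟨ι₀⟩ := PadicAlgCl.nonempty_ringEquiv_complex p
  obtain ⟨ι', -, hι'⟩ := exists_datum_forall_mem_iff p ι₀ hK h𝔭
  obtain ⟨ΩK, Ωp, Q, hΩK, hQ⟩ := exists_isBDPLFunctionInt_of_thmA_anyLevel hA W p K Dt.f Dt.isNewformOf
    (by omega) hbad hK hHN κ hκ γ 𝔭 h𝔭 ι' hι'
  exact ⟨Dt.f, Dt.isNewformOf, ι', hι', ΩK, Ωp, Q, hΩK, hQ⟩

end Summit.BirchSwinnertonDyer.BirchSwinnertonDyer.Theorems.BiquadraticEisensteinDescentKatzWaldspurgerFrameCMInertBadFromPrint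

end
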